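import Summits.HodgeConjecture.HodgeConjecture.Theorems.H413CuspCotTower
import Summits.HodgeConjecture.HodgeConjecture.Theorems.H413CuspCotTransport
import Summits.HodgeConjecture.HodgeConjecture.Theorems.P4StubT1ArchFactor
import HarnessLib

/-!
# FLOOR-0 P4, stub T2′ (hol half) — ONE class map on the holomorphic cotangent forms of the factor of record:
# `clsHol : holCotForms (archFactorOf F V) →ₗ[ℂ] Tower … V`, INJECTIVE and `U(V)(𝔸_f)`-EQUIVARIANT

Cell hodgecm-mathlib (D-0151), FLOOR 0, crux item H413 = stmt-HodgeConjecture-24833; programme P4, line `Cruxes/H413/Lines/P4AdmissibleOccursInH1.lean`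
v2.1, stub `stub_T2_matsushimaHodgeAt`.  Author A-p13 (g21).  `--supports stmt-HodgeConjecture-24833 --as helper`.

Assembly of the three previous files: a holomorphic cotangent form `f` for `𝔞₀ = archFactorOf F V` is smooth, hence fixed by an OPEN subgroup
`K_f` (`exists_isOpen_forall_rightRep_eq`); read on the regime model it is a saturated cuspidal cotangent form of the PKG level `Level.capThree K_f`
(`Theorems/H413CuspCotTransport`), whose tower class `clsAt` (`Theorems/H413CuspCotTower`) does not depend on the level (`clsAt_of_le`).  Hence ONE map
* `clsHol hHD hI h₁ h₃ hA hV : holCotForms (archFactorOf F V) →ₗ[ℂ] Tower hHD hI _ h₃ hA V`, with `clsHol_eq_clsAt` (computed at ANY admissible level);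
* **`clsHol_rightRep`** — `clsHol (R_g f) = act g (clsHol f)` (`clsAt_rightShift` + `toRegimeFun_rightRep`);
* **`clsHol_injective`** — `clsAt_eq_zero_iff` + `comp_toRegimeFun` + the honesty of the factor of record (★ `P4StubT1ArchFactor.archFactorOf_isHonest`,
  through ★ `H413CohFormsCarriersLemmas`-style «components determine the form», here re-derived from `IsHonest` clause (6) in two lines).
What is left of T2′ after this file: `rhoB τ' = act` for the pin's `Representation.ofModule'` structure (S) and the `(0,1)` half (conjugation on the tower).
HC_CM is proved only modulo the 7 printed citations until rung 0 closes; this file proves nothing about them.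
[cite: BorelWallach2000, VII 3.2; XIII 1.2] [cite: BorelJacquet1979, §4.2]

## References
* [BorelWallach2000] VII 3.2, XIII 1.2.  * [BorelJacquet1979] §4.2.
* Tree: `Theorems/H413CuspCotComponents`, `H413CuspCotTower`, `H413CuspCotTransport`, `P4StubT1ArchFactor`, P0 `H413CohFormsCarriers`;
  HodgeCM `Model/AdelicThetaDistributionSat_1` (`Level.capThree`), `CM/Basic` (`Level.le_def`).
-/

set_option autoImplicit false
set_option linter.dupNamespace false

noncomputable section

open MulAction NumberField
open Literature.NumberTheory.Automorphic
open Literature.Geometry.ComplexHyperbolic.BallModel (U21 x₀)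
open Literature.AlgebraicGeometry.ShimuraVarieties Literature.AlgebraicGeometry.HodgeTheory
open Literature.NumberTheory.Automorphic.PicardCM
open Literature.NumberTheory.Transcendental (Arapura2012_Cor_15_4_6)
open HodgeCM HodgeCM.Model HodgeCM.Model.ThetaSpace HodgeCM.Model.TowerCarrier
open Summit.HodgeConjecture.HodgeConjecture.Cruxes.H413.CohFormsCarriers

namespace Summit.HodgeConjecture.HodgeConjecture.Cruxes.H413.CuspCot

variable {F : HodgeCM.CMField} {ι₁ : F →+* ℂ} {V : HodgeCM.HermSpace3 F ι₁}

/-! ## §1 Every smooth function is fixed by an open subgroup -/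

/-- A `K_f`-smooth function (an element of the span of the `K`-invariants over open `K`) is fixed by ONE open subgroup (finite intersections of
open subgroups are open). [cite: BorelJacquet1979, §4.2] -/
theorem exists_isOpen_forall_rightRep_eq {f : (adelicDatum F V).Adelic → (Fin 2 → ℂ)} (hf : f ∈ smoothFun F V) :
    ∃ K : Subgroup ↥(HodgeCM.HermSpace3.adelicFin V), IsOpen (K : Set ↥(HodgeCM.HermSpace3.adelicFin V)) ∧ ∀ k ∈ K, rightRep F V k f = f := by
  refine Submodule.iSup_induction _
    (motive := fun f => ∃ K : Subgroup ↥(HodgeCM.HermSpace3.adelicFin V), IsOpen (K : Set ↥(HodgeCM.HermSpace3.adelicFin V)) ∧ ∀ k ∈ K, rightRep F V k f = f) hf ?_ ?_ ?_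
  · intro K f' hf'
    refine Submodule.iSup_induction _
      (motive := fun f => ∃ K : Subgroup ↥(HodgeCM.HermSpace3.adelicFin V), IsOpen (K : Set ↥(HodgeCM.HermSpace3.adelicFin V)) ∧ ∀ k ∈ K, rightRep F V k f = f) hf' ?_ ?_ ?_
    · intro hK f'' hf''
      exact ⟨K, hK, fun k hk => (Representation.mem_invariants _ _).1 hf'' ⟨k, hk⟩⟩
    · exact ⟨⊤, isOpen_univ, fun k _ => by simp⟩
    · rintro a b ⟨Ka, hKa, ha⟩ ⟨Kb, hKb, hb⟩
      refine ⟨Ka ⊓ Kb, ?_, fun k hk => by rw [map_add, ha k hk.1, hb k hk.2]⟩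
      rw [Subgroup.coe_inf]; exact hKa.inter hKb
  · exact ⟨⊤, isOpen_univ, fun k _ => by simp⟩
  · rintro a b ⟨Ka, hKa, ha⟩ ⟨Kb, hKb, hb⟩
    refine ⟨Ka ⊓ Kb, ?_, fun k hk => by rw [map_add, ha k hk.1, hb k hk.2]⟩
    rw [Subgroup.coe_inf]; exact hKa.inter hKb

/-- A holomorphic cotangent form is fixed by an open subgroup. [cite: BorelJacquet1979, §4.2] -/
theorem exists_isOpen_forall_rightRep_eq_of_mem_holCotForms {𝔞 : ArchFactor F V} {f : (adelicDatum F V).Adelic → (Fin 2 → ℂ)}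
    (hf : f ∈ holCotForms 𝔞) :
    ∃ K : Subgroup ↥(HodgeCM.HermSpace3.adelicFin V), IsOpen (K : Set ↥(HodgeCM.HermSpace3.adelicFin V)) ∧ ∀ k ∈ K, rightRep F V k f = f :=
  exists_isOpen_forall_rightRep_eq hf.1.2

section Cls

variable (hHD : exists_isReal_hodgeModel) (hI : hodgePQ_independent_of_hodgeModel)
  (h₁ : BallQuotientUniformised) (h₃ : CMAbelianVarietyRealised) (hA : Arapura2012_Cor_15_4_6)
variable (hV : IsAnisotropic F (HodgeCM.HermSpace3.Hm V))

/-! ## §2 The level of a form and its tower class -/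

/-- A chosen open subgroup fixing `f`. [cite: BorelJacquet1979, §4.2] -/
def fixK (f : ↥(holCotForms (archFactorOf F V))) : Subgroup ↥(HodgeCM.HermSpace3.adelicFin V) :=
  (exists_isOpen_forall_rightRep_eq_of_mem_holCotForms f.2).choose

/-- `fixK f` is open. [cite: BorelJacquet1979, §4.2] -/
theorem isOpen_fixK (f : ↥(holCotForms (archFactorOf F V))) : IsOpen (fixK f : Set ↥(HodgeCM.HermSpace3.adelicFin V)) :=
  (exists_isOpen_forall_rightRep_eq_of_mem_holCotForms f.2).choose_spec.1

/-- `fixK f` fixes `f`. [cite: BorelJacquet1979, §4.2] -/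
theorem rightRep_eq_of_mem_fixK (f : ↥(holCotForms (archFactorOf F V))) {k : ↥(HodgeCM.HermSpace3.adelicFin V)} (hk : k ∈ fixK f) :
    rightRep F V k (f : _) = f :=
  (exists_isOpen_forall_rightRep_eq_of_mem_holCotForms f.2).choose_spec.2 k hk

/-- **The level of `f`**: the PKG level `(U(V)(L⁺) ∩ (K_f(3) ∩ fixK f), K_f(3) ∩ fixK f)` below `K_f(3)`. [cite: BorelWallach2000, XIII 1.2] -/
def levelOf (f : ↥(holCotForms (archFactorOf F V))) : Level V :=
  Level.capThree (fixK f) (isOpen_fixK f)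

/-- `levelOf f` is below a conjugate of `K_f(3)`. [cite: BorelWallach2000, XIII 1.2] -/
theorem belowConjThree_levelOf (f : ↥(holCotForms (archFactorOf F V))) : (levelOf f).BelowConjThree :=
  Level.belowConjThree_capThree _ _

/-- Read on the regime model, `f` is a saturated cuspidal cotangent form of its level. [cite: BorelWallach2000, XIII 1.2] -/
theorem toRegimeFun_mem_cuspCotSat_levelOf (f : ↥(holCotForms (archFactorOf F V))) :
    toRegimeFun F V hV (f : _) ∈ cuspCotSat V hV (levelOf f).K :=
  cuspCotSat_anti (Level.capThree_K_le _ _) (toRegimeFun_mem_cuspCotSat f.2 (fun _ hk => rightRep_eq_of_mem_fixK f hk))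

/-- **The class of `f`**, computed at `levelOf f`. [cite: BorelWallach2000, VII 3.2; XIII 1.2] -/
def cls10 (f : ↥(holCotForms (archFactorOf F V))) : Tower hHD hI (ballQuotientUniformisedDatum_of h₁) h₃ hA V :=
  clsAt hHD hI h₁ h₃ hA (levelOf f) (belowConjThree_levelOf f) ⟨_, toRegimeFun_mem_cuspCotSat_levelOf hV f⟩

/-- **The class may be computed at ANY level at which `f ∘ e⁻¹` is a form** (common refinement + `clsAt_of_le`). [cite: BorelWallach2000, XIII 1.2] -/
theorem cls10_eq_clsAt (f : ↥(holCotForms (archFactorOf F V))) {Γ : Level V} (hΓ : Γ.BelowConjThree)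
    (hmem : toRegimeFun F V hV (f : _) ∈ cuspCotSat V hV Γ.K) :
    cls10 hHD hI h₁ h₃ hA hV f = clsAt hHD hI h₁ h₃ hA Γ hΓ ⟨_, hmem⟩ := by
  -- common refinement `Γ'' = capThree (Γ.K ⊓ (levelOf f).K)`
  have hKo : IsOpen ((Γ.K ⊓ (levelOf f).K : Subgroup ↥(HodgeCM.HermSpace3.adelicFin V)) : Set ↥(HodgeCM.HermSpace3.adelicFin V)) := by
    rw [Subgroup.coe_inf]; exact Γ.isOpen_K.inter (levelOf f).isOpen_K
  have hle1 : Level.capThree (Γ.K ⊓ (levelOf f).K) hKo ≤ Γ :=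
    Level.le_def.2 ((Level.capThree_K_le _ _).trans inf_le_left)
  have hle2 : Level.capThree (Γ.K ⊓ (levelOf f).K) hKo ≤ levelOf f :=
    Level.le_def.2 ((Level.capThree_K_le _ _).trans inf_le_right)
  rw [cls10, ← clsAt_of_le hHD hI h₁ h₃ hA hle2 (belowConjThree_levelOf f) (Level.belowConjThree_capThree _ hKo),
    ← clsAt_of_le hHD hI h₁ h₃ hA hle1 hΓ (Level.belowConjThree_capThree _ hKo)]

/-! ## §3 The class map: linear, equivariant, injective -/

/-- **`clsHol : holCotForms 𝔞₀ →ₗ[ℂ] Tower … V`.** [cite: BorelWallach2000, VII 3.2; XIII 1.2] -/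
def clsHol : ↥(holCotForms (archFactorOf F V)) →ₗ[ℂ] Tower hHD hI (ballQuotientUniformisedDatum_of h₁) h₃ hA V where
  toFun := cls10 hHD hI h₁ h₃ hA hV
  map_add' f f' := by
    -- compute all three classes at the level of `f + f'` refined by the levels of `f` and `f'`: simplest, at `capThree (fixK f ⊓ fixK f')`
    have hKo : IsOpen ((fixK f ⊓ fixK f' : Subgroup ↥(HodgeCM.HermSpace3.adelicFin V)) : Set ↥(HodgeCM.HermSpace3.adelicFin V)) := by
      rw [Subgroup.coe_inf]; exact (isOpen_fixK f).inter (isOpen_fixK f')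
    have hf : toRegimeFun F V hV (f : _) ∈ cuspCotSat V hV (Level.capThree _ hKo).K :=
      cuspCotSat_anti (Level.capThree_K_le _ _) (toRegimeFun_mem_cuspCotSat f.2 (fun _ hk => rightRep_eq_of_mem_fixK f hk.1))
    have hf' : toRegimeFun F V hV (f' : _) ∈ cuspCotSat V hV (Level.capThree _ hKo).K :=
      cuspCotSat_anti (Level.capThree_K_le _ _) (toRegimeFun_mem_cuspCotSat f'.2 (fun _ hk => rightRep_eq_of_mem_fixK f' hk.2))
    have hff' : toRegimeFun F V hV ((f + f' : ↥(holCotForms (archFactorOf F V))) : _) ∈ cuspCotSat V hV (Level.capThree _ hKo).K := by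
      rw [Submodule.coe_add, map_add]; exact Submodule.add_mem _ hf hf'
    rw [cls10_eq_clsAt hHD hI h₁ h₃ hA hV _ (Level.belowConjThree_capThree _ hKo) hff',
      cls10_eq_clsAt hHD hI h₁ h₃ hA hV _ (Level.belowConjThree_capThree _ hKo) hf,
      cls10_eq_clsAt hHD hI h₁ h₃ hA hV _ (Level.belowConjThree_capThree _ hKo) hf', ← map_add]
    congr 1
  map_smul' r f := by
    have hf : toRegimeFun F V hV (f : _) ∈ cuspCotSat V hV (levelOf f).K := toRegimeFun_mem_cuspCotSat_levelOf hV f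
    have hrf : toRegimeFun F V hV ((r • f : ↥(holCotForms (archFactorOf F V))) : _) ∈ cuspCotSat V hV (levelOf f).K := by
      rw [Submodule.coe_smul, map_smul]; exact Submodule.smul_mem _ r hf
    rw [RingHom.id_apply, cls10_eq_clsAt hHD hI h₁ h₃ hA hV _ (belowConjThree_levelOf f) hrf, cls10, ← map_smul]
    congr 1

/-- Unfolding `clsHol`. [cite: BorelWallach2000, XIII 1.2] -/
theorem clsHol_apply (f : ↥(holCotForms (archFactorOf F V))) : clsHol hHD hI h₁ h₃ hA hV f = cls10 hHD hI h₁ h₃ hA hV f := rfl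

/-- `clsHol f` computed at any admissible level. [cite: BorelWallach2000, XIII 1.2] -/
theorem clsHol_eq_clsAt (f : ↥(holCotForms (archFactorOf F V))) {Γ : Level V} (hΓ : Γ.BelowConjThree)
    (hmem : toRegimeFun F V hV (f : _) ∈ cuspCotSat V hV Γ.K) :
    clsHol hHD hI h₁ h₃ hA hV f = clsAt hHD hI h₁ h₃ hA Γ hΓ ⟨_, hmem⟩ :=
  cls10_eq_clsAt hHD hI h₁ h₃ hA hV f hΓ hmem

/-- **`U(V)(𝔸_f)`-EQUIVARIANCE**: `clsHol (R_g f) = act g (clsHol f)`. [cite: BorelWallach2000, XIII 1.2] -/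
theorem clsHol_rightRep (g : ↥(HodgeCM.HermSpace3.adelicFin V)) (f : ↥(holCotForms (archFactorOf F V)))
    (hgf : rightRep F V g (f : _) ∈ holCotForms (archFactorOf F V)) :
    clsHol hHD hI h₁ h₃ hA hV ⟨rightRep F V g (f : _), hgf⟩ = act hHD hI (ballQuotientUniformisedDatum_of h₁) h₃ hA g (clsHol hHD hI h₁ h₃ hA hV f) := by
  have hf : toRegimeFun F V hV (f : _) ∈ cuspCotSat V hV (levelOf f).K := toRegimeFun_mem_cuspCotSat_levelOf hV f
  have hgf' : toRegimeFun F V hV (rightRep F V g (f : _)) ∈ cuspCotSat V hV ((levelOf f).conj g (belowConjThree_levelOf f)).K := by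
    rw [toRegimeFun_rightRep]; exact rightShift_mem_cuspCotSat_conj (belowConjThree_levelOf f) hf g
  rw [clsHol_eq_clsAt hHD hI h₁ h₃ hA hV _ ((belowConjThree_levelOf f).conj g) hgf', clsHol_apply, cls10,
    ← clsAt_rightShift hHD hI h₁ h₃ hA (belowConjThree_levelOf f) ⟨_, hf⟩ g]
  congr 1
  apply Subtype.ext
  exact toRegimeFun_rightRep F V hV g f

/-- **`ℂ[U(V)(𝔸_f)]`-module form of the equivariance**: `of g • clsHol f = clsHol (R_g f)`. [cite: BorelWallach2000, XIII 1.2] -/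
theorem of_smul_clsHol (g : ↥(HodgeCM.HermSpace3.adelicFin V)) (f : ↥(holCotForms (archFactorOf F V)))
    (hgf : rightRep F V g (f : _) ∈ holCotForms (archFactorOf F V)) :
    MonoidAlgebra.of ℂ ↥(HodgeCM.HermSpace3.adelicFin V) g • clsHol hHD hI h₁ h₃ hA hV f =
      clsHol hHD hI h₁ h₃ hA hV ⟨rightRep F V g (f : _), hgf⟩ := by
  rw [of_smul_eq_act, clsHol_rightRep]

/-- **INJECTIVITY of the class map on holomorphic cotangent forms** (`clsAt_eq_zero_iff`: all components vanish; `comp_toRegimeFun`: these are the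
components of `f`; the factor of record is honest — ★ `archFactorOf_isHonest` — so the components determine `f`). [cite: BorelWallach2000, VII 3.2] -/
theorem clsHol_injective : Function.Injective (clsHol hHD hI h₁ h₃ hA hV) := by
  rw [injective_iff_map_eq_zero]
  intro f hf0
  have h0 := (clsAt_eq_zero_iff hHD hI h₁ h₃ hA (belowConjThree_levelOf f) ⟨_, toRegimeFun_mem_cuspCotSat_levelOf hV f⟩).1 hf0
  apply Subtype.ext
  -- components of `f` vanish
  have hcomp : ∀ (u : ↥U21) (h : ↥(HodgeCM.HermSpace3.adelicFin V)), (f : (adelicDatum F V).Adelic → (Fin 2 → ℂ)) ((archFactorOf F V).ιinf u * finToAdelic F V h) = 0 := by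
    intro u h
    have := congrFun (h0 h) u
    rw [comp_toRegimeFun] at this
    exact this
  -- honesty clause (6): every point is `ιinf u · k · (1,h)` with `k ∈ K_c`; `f` is right-`K_c`-invariant
  obtain ⟨_, _, _, _, hcommKF, hdec, _⟩ := Summit.HodgeConjecture.HodgeConjecture.Cruxes.H413.P4StubT1ArchFactor.archFactorOf_isHonest F V
  funext x
  obtain ⟨u, k, h, hk, rfl⟩ := hdec x
  rw [mul_assoc, hcommKF k hk h, ← mul_assoc, f.2.1.1.2 k hk]
  exact hcomp u h

end Cls

end Summit.HodgeConjecture.HodgeConjecture.Cruxes.H413.CuspCot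

end
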